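import Summits.BirchSwinnertonDyer.Rank1Residual.GaloisImage.SmallImageInertiaOrder
import Literature.NumberTheory.DiophantineGeometry.Conductor
import HarnessLib

/-!
# EVIDENCE item NIV3-J (census-discovered, CANDIDATE — NOT a theorem, NOT a Literature fact): on a
# tame inertia image at the additive prime `3`, the niveau is read on `v₃(j − 1728)`
# (cell `b2b-bsdres`, lane CLASS-CLOSURE, seat cc-typer-1 = typer of record N11 / O8; deliverable (a)
# "the discovered statement as an EVIDENCE-labelled conjecture declaration";
# `class-closure/typer-1/NIV3-report-typer1.md` da8f8a075c695ba9, pre-registration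
# `class-closure/typer-1/NIV3-prereg-typer1.md` 9c330550f07effae, rows `class-closure/O8/NIV3-census-typer1.tsv`
# 234f4963749a1371, kit j131140)

HONEST FRAMING (cell `b2b-bsdres`, run/shared/lean/b2b/bsd-rank1-residual/, verbatim in every
file): the goal of the cell is to DELETE the COMBINATION-SHAPED residual classes of the
Birch–Swinnerton-Dyer formula for ALL analytic-rank `≤ 1` elliptic curves over `ℚ` — "full BSD
formula for every rank `≤ 1` curve in class `C`" assembled STRICTLY from published theorems — so
that the rank-`≤ 1` remainder becomes exactly the CONSTRUCTION-SHAPED classes, which are TYPED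
(missing-input `Prop`s), NOT attempted. This is not "finishing BSD". Lane CLASS-CLOSURE: census
output = EVIDENCE / conjecture items with held-out validation, NEVER a Literature fact; nothing is
booked here; no mark moves. This file declares ONE `@[conjecture]` predicate (a census-discovered
CANDIDATE law, typed so that provers / refuters / the census can target THE statement, not a
paraphrase) and proves nothing about it.

## The statement and its standing

THEOREM-LEVEL CONTEXT (kernel, this seat): for every `E/ℚ` and every inertia group `I_𝔓` at `3`
with `3 ∤ e₃ := #ρ̄_{E,3}(I_𝔓)` one has `e₃ = 2` (`E[3]|_I ≅ ω ⊕ 1`, `InertiaSplitAt`, niveau 1) or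
`e₃ = 8` (`E[3]|_I ≅ 𝔽₉(ψ₂)`, no stable line, niveau 2) — `GaloisImage/SmallImageNiveauDichotomy`
(`card_inertia_map_three_eq_two_or_eq_eight`); every O8 / N2 row has `3 ∤ e₃`
(`SmallImageInertiaOrder`).  WHICH of the two happens is, on the census, a function of `j` alone:

**NIV3-J (CANDIDATE).** *For `E/ℚ` with ADDITIVE reduction at `3` (`f₃ ≥ 2`) and `3 ∤ e₃`:
`e₃ = 8 ⟺ (j = 1728 or v₃(j − 1728) ≥ 5)`; otherwise `e₃ = 2`.*

EVIDENCE (numbers, not adjectives; `NIV3-report-typer1.md`): (i) O8 = `ClassX4 ∧ ¬surj(3)` rows at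
`p = 3`: **1 334/1 334** ((M) 147: `v₃(j−1728) < 0`, `e₃ = 2`; (G-ord) 97: `v = 0`, `e₃ = 2`; tame
pot-supersingular 443: `v ∈ [6, 12]`, `e₃ = 8` — pre-registered hypothesis H-A, 443/443; WILD
(`f₃ = 3`) 647: `v = 3 ↦ e₃ = 2` on 261, `v = 5 ↦ e₃ = 8` on 386, no other value occurs); the wild
part of the law was READ from the pooled `(v₃c₄, v₃c₆, v₃Δ)` table of the 421 wild `3Nn` rows (so the
registered FIT 209/209 / HELDOUT 212/212 halves are NOT a blind validation — said); (ii) INDEPENDENT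
VALIDATION, blind for the wild part: the 441 control curves (curve 1 of every Cremona class,
`N ≤ 2000`, `9 ∣ N`, `3 ∤ e_lcm`, not an O8 row): **441/441** — surjective mod-3 image 240 (166 tame,
74 wild: `v = 5`, `e = 8`), reducible `3B/3Cs` 183 (98 tame, 85 wild: `v = 3`, `e = 2`), `3Nn` 18.
Engines: `e₃` = ramification index of `3` in `ℚ(E[3])` (PARI `nfsplitting`/`idealprimedec`) = lcm of
inertia-orbit sizes on `E[3] ∖ 0` from the `3`-division polynomial (two routes, 1 334/1 334 equal).
STATUS: CANDIDATE (EVIDENCE tier). NOT used by any certificate; no BSD quantity involved. A proof would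
go through the explicit `3`-division field of a potentially good curve at `3` (Kraus 1990-type case
analysis on `(v₃c₄, v₃c₆, v₃Δ)`); a single counterexample `E/ℚ` refutes it. Consumers: the census key
of the NIVEAU sub-partition of O8 / N11-TAME wild rows (`O8/SUBPARTITION-typed.md` v1.8).

Typed atoms (tree vocabulary only): `W.conductorExponent v` (Ogg exponent `f_v`,
`Literature/…/DiophantineGeometry/Conductor.lean`), `Nat.card ((𝔓.inertia Γ_ℚ).map (galoisRepTorsion W 3))`
(p02's `e₃`), `padicValRat 3 (W.j − 1728)` (p02's ARM A currency; Lean's `padicValRat 3 0 = 0` forces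
the explicit `j = 1728` disjunct — the six `j = 1728` control curves have `e = 8`).

STATUS ⟦cc-typer-5 GEN 17 (O5/O6 typer; one-off cross-axis touch docketed by cc-lead ⟦gen67⟧ (2′) rider (r6), cc-typer-1 not seated)⟧: NIV3-J
`NiveauByJAtThree` is now a THEOREM — PROVED AS TYPED by n1011-p06, `GaloisImage.niveauByJAtThree_holds` (`GaloisImage/ThreeTorsionNiveauByJHolds.lean`, p338316 ACCEPTED, commit 98c6534ae65d;
over `Additive/LocIrrInertiaStableLine.lean`; binders verbatim, axioms standard); its `@[conjecture]` attribute is DROPPED below, decl text byte-identical; the census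
numbers stay EVIDENCE and their counts are unchanged; a `_holds` closes no pair and moves no mark (`class-closure/O8/SUBPARTITION-typed.md` row log line of the same date).
-/

noncomputable section

open scoped NumberField
open Field IsDedekindDomain WeierstrassCurve NumberField
  Literature.NumberTheory.EllipticCurves Literature.NumberTheory.GaloisRepresentations

namespace Summit.BirchSwinnertonDyer.Rank1Residual.GaloisImage

/-- **NIV3-J — THEOREM: PROVED AS TYPED by n1011-p06, `GaloisImage.niveauByJAtThree_holds` (`GaloisImage/ThreeTorsionNiveauByJHolds.lean`, p338316 ACCEPTED, commit 98c6534ae65d);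
`@[conjecture]` DROPPED ⟦cc-typer-5 GEN 17, rider (r6) of cc-lead ⟦gen67⟧ (2′)⟧, statement bytes unchanged; census = EVIDENCE (counts unchanged); closes no pair.**
**(As typed: EVIDENCE, CANDIDATE; census-discovered by cc-typer-1 GEN 8, kit j131140; report
`class-closure/typer-1/NIV3-report-typer1.md` da8f8a075c695ba9).** For every elliptic curve `E = W/ℚ`,
every place `v ∋ 3` at which `W` is ADDITIVE (`f_v ≥ 2`) and every prime `𝔓 ∣ v` of `ℤ̄` whose inertia
image on `E[3]` has order `e₃` prime to `3`: `e₃ = 8` (niveau 2) iff `j = 1728` or `v₃(j − 1728) ≥ 5`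
(and otherwise `e₃ = 2`, niveau 1, by the kernel dichotomy). O8: 1 334/1 334; independent control
441/441; as typed 'NOT a theorem' — now PROVED AS TYPED (p338316); nothing is booked on it. [conjecture — census EVIDENCE, class-closure NIV3; THEOREM p338316] -/
def NiveauByJAtThree : Prop :=
  ∀ (W : WeierstrassCurve ℚ) [W.IsElliptic] (v : HeightOneSpectrum (𝓞 ℚ)),
    ((3 : ℕ) : 𝓞 ℚ) ∈ v.asIdeal → 2 ≤ W.conductorExponent v →
    ∀ 𝔓 : Ideal (absIntegers (𝓞 ℚ) ℚ), 𝔓 ∈ v.primesAbove →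
      ¬ 3 ∣ Nat.card ((𝔓.inertia (absoluteGaloisGroup ℚ)).map (galoisRepTorsion W 3)) →
      (Nat.card ((𝔓.inertia (absoluteGaloisGroup ℚ)).map (galoisRepTorsion W 3)) = 8 ↔
        (W.j = 1728 ∨ 5 ≤ padicValRat 3 (W.j - 1728)))

/-- Reading of NIV3-J on one curve (bookkeeping; assumes the conjecture as a hypothesis, proves
nothing about it): under `NiveauByJAtThree`, an additive curve at `3` with `3 ∤ e₃` and
`v₃(j − 1728) < 5`, `j ≠ 1728`, has `e₃ ≠ 8` (hence `e₃ = 2` by the kernel dichotomy). [folklore] -/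
theorem NiveauByJAtThree.card_ne_eight (h : NiveauByJAtThree) (W : WeierstrassCurve ℚ) [W.IsElliptic]
    {v : HeightOneSpectrum (𝓞 ℚ)} (hv : ((3 : ℕ) : 𝓞 ℚ) ∈ v.asIdeal) (hf : 2 ≤ W.conductorExponent v)
    {𝔓 : Ideal (absIntegers (𝓞 ℚ) ℚ)} (h𝔓 : 𝔓 ∈ v.primesAbove)
    (he : ¬ 3 ∣ Nat.card ((𝔓.inertia (absoluteGaloisGroup ℚ)).map (galoisRepTorsion W 3)))
    (hj : W.j ≠ 1728) (hvj : padicValRat 3 (W.j - 1728) < 5) :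
    Nat.card ((𝔓.inertia (absoluteGaloisGroup ℚ)).map (galoisRepTorsion W 3)) ≠ 8 := by
  intro h8
  rcases (h W v hv hf 𝔓 h𝔓 he).mp h8 with h1 | h1
  · exact hj h1
  · exact absurd hvj (not_lt.mpr h1)

end Summit.BirchSwinnertonDyer.Rank1Residual.GaloisImage

end
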